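import Summits.ResolutionOfSingularities.ResolutionOfSingularities.Theorems.PAlterationPicoverRegularLocusNormalForm
import Summits.ResolutionOfSingularities.ResolutionOfSingularities.Theorems.PAlterationPicoverNormalizationInCodimOne
import Summits.ResolutionOfSingularities.ResolutionOfSingularities.Theorems.PAlterationPicoverNormalFormSepOfPointwise
import HarnessLib

set_option linter.dupNamespace false -- mandated namespace of this single-conjunct summit

/-!
# Separated Giraud normal form in dimension `≤ 1` (calibration slice)

Crux `Picover` (stmt-ResolutionOfSingularities-0554), line `giraud-separated-base`, stub
`giraudNormalFormSep_of_dim_le_one` — the dimension `≤ 1` case of the research stub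
`stub_giraudNormalFormSep` (Giraud's normal-form conjecture), proved with `W' = W`, `ρ = 𝟙`,
and EMPTY boundary.

**Setting.** `k` a field of characteristic `p`, `W` a regular integral scheme locally of finite
type over `k` with `dim W ≤ 1`, `L ⊇ K(W)` purely inseparable of degree `p`,
`W^L = normalizationIn W L` with structure map `ι : W^L → W`.

**Proof.** By `NormalFormSepOfPointwise.giraudNormalFormSep_of_pointwise_zero` it suffices to
produce, at every `w ∈ W`, a representative `b ∈ 𝒪_{W,w}` of the class of `L` in boundary-free
Giraud normal form.  The map `ι` is surjective (integral, hence closed, and dominant), so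
`w = ι x` for some `x ∈ W^L`.  Since `ι` is finite (E. Noether), it is locally quasi-finite and
`dim W^L ≤ dim W ≤ 1` (incomparability), so `dim 𝒪_{W^L,x} ≤ 1` and the normal local ring
`𝒪_{W^L,x}` is regular
(`NormalizationInCodimOne.isRegularLocalRing_stalk_normalizationIn_of_ringKrullDim_le_one`).
The bridge `RegularLocusNormalForm.isRegularLocalRing_stalk_iff_exists_giraudNormalFormAt_zero`
(direction `mp`, at the regular point `w = ι x`) then yields the required `b`.
-/

noncomputable section

open CategoryTheory AlgebraicGeometry Literature.AlgebraicGeometry.Resolution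

namespace Summit.ResolutionOfSingularities.ResolutionOfSingularities.Theorems.Picover.NormalFormSepDimLeOne

/-- `W^L → W` is surjective on points: it is integral, hence closed, and dominant, so its range
is a dense closed subset. [folklore] -/
private theorem surjective_normalizationInι_base (W : Scheme.{0}) [IsIntegral W] (L : Type)
    [Field L] [Algebra W.functionField L] :
    Function.Surjective (normalizationInι W L).base := by
  intro w
  have hcl : IsClosed (Set.range (normalizationInι W L).base) :=
    (normalizationInι W L).isClosedMap.isClosed_range
  have hd : Dense (Set.range (normalizationInι W L).base) := (normalizationInι W L).denseRange
  have h : Set.range (normalizationInι W L).base = Set.univ := by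
    rw [← hd.closure_eq, hcl.closure_eq]
  exact Set.range_eq_univ.mp h w

/-- `dim 𝒪_{X,x} ≤ dim X`: `dim 𝒪_{X,x}` is the coheight of `x` in the specialization order
(Stacks 02IZ), bounded by the Krull dimension of the lattice of irreducible closed subsets.
[folklore] -/
private theorem ringKrullDim_stalk_le_topologicalKrullDim' (X : Scheme.{0}) (x : X) :
    ringKrullDim (X.presheaf.stalk x) ≤ topologicalKrullDim X := by
  rw [AlgebraicGeometry.ringKrullDim_stalk_eq_coheight, topologicalKrullDim,
    Order.krullDim_eq_of_orderIso (irreducibleSetEquivPoints (α := X))]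
  exact Order.coheight_le_krullDim x

/-- **Separated Giraud normal form in dimension `≤ 1`.**  For `k` a field of characteristic `p`,
`W` a regular integral scheme locally of finite type over `k` with `dim W ≤ 1`, and `L ⊇ K(W)`
purely inseparable of degree `p`, the conclusion of `stub_giraudNormalFormSep` holds (with
`W' = W`, `ρ = 𝟙 W`, empty boundary): the normalization `W^L` has dimension `≤ 1`, hence is
regular at every point, so by the regular-locus bridge every `w ∈ W` carries a representative of
the class of `L` in boundary-free Giraud normal form, and these are packaged by
`giraudNormalFormSep_of_pointwise_zero`. -/
theorem giraudNormalFormSep_of_dim_le_one : ∀ (p : ℕ), p.Prime → ∀ (k : Type) [Field k] [CharP k p] (W : Scheme.{0}) [IsIntegral W] (f : W ⟶ Spec (.of k)) (L : Type) [Field L] [Algebra W.functionField L], IsSeparated f → LocallyOfFiniteType f → QuasiCompact f → Scheme.IsRegular W → IsPurelyInseparable W.functionField L → Module.finrank W.functionField L = p → topologicalKrullDim W ≤ 1 → ∃ (W' : Scheme.{0}) (ρ : W' ⟶ W) (E : List W'.IdealSheafData), IsProper ρ ∧ IsBirational ρ ∧ IsIntegral W' ∧ Scheme.IsRegular W' ∧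 HasSNC E ∧ ∀ w' : W', ∃ (r : ℕ) (D : Fin r → {D : W'.IdealSheafData // D ∈ E ∧ w' ∈ D.support}) (x : Fin r → W'.presheaf.stalk w'), Function.Bijective D ∧ (∀ j, stalkIdeal (D j).1 w' = Ideal.span {x j}) ∧ ∃ b : W.presheaf.stalk (ρ.base w'), (∃ y : L, y ∉ (algebraMap W.functionField L).range ∧ y ^ p = algebraMap W.functionField L (algebraMap (W.presheaf.stalk (ρ.base w')) W.functionField b)) ∧ GiraudNormalFormAt p x ((ρ.stalkMap w').hom b) := by
  intro p hp k _ _ W _ f L _ _ _hsep hlft _hqc hWreg hPI hdeg hdim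
  haveI : Fact p.Prime := ⟨hp⟩
  haveI := hlft
  haveI := hPI
  haveI : FiniteDimensional W.functionField L :=
    Module.finite_of_finrank_pos (by rw [hdeg]; exact hp.pos)
  refine NormalFormSepOfPointwise.giraudNormalFormSep_of_pointwise_zero p k W f L hWreg
    fun w => ?_
  -- every point of `W` is the image of a point of `W^L`
  obtain ⟨x, rfl⟩ := surjective_normalizationInι_base W L w
  -- `dim W^L ≤ dim W ≤ 1` (`ι` is finite, hence locally quasi-finite: incomparability)
  haveI : IsFinite (normalizationInι W L) := isFinite_normalizationInι W L f
  have hdimL : topologicalKrullDim ↥(normalizationIn W L) ≤ 1 :=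
    (Literature.AlgebraicGeometry.Motives.Scheme.topologicalKrullDim_le_of_locallyQuasiFinite
      (normalizationInι W L)).trans hdim
  -- so the normal local ring `𝒪_{W^L,x}` has dimension `≤ 1`, hence is regular
  have hx : ringKrullDim ((normalizationIn W L).presheaf.stalk x) ≤ 1 :=
    (ringKrullDim_stalk_le_topologicalKrullDim' _ x).trans hdimL
  have hxreg : IsRegularLocalRing ((normalizationIn W L).presheaf.stalk x) :=
    NormalizationInCodimOne.isRegularLocalRing_stalk_normalizationIn_of_ringKrullDim_le_one
      k W f L x hx
  -- the bridge at the regular point `w = ι x`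
  exact (RegularLocusNormalForm.isRegularLocalRing_stalk_iff_exists_giraudNormalFormAt_zero
    p k W f L hdeg x (hWreg _)).mp hxreg

end Summit.ResolutionOfSingularities.ResolutionOfSingularities.Theorems.Picover.NormalFormSepDimLeOne

end
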